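import Summits.Ventures.Crystal3D.Theorems.StickyWulffConstantPolycrystalWulffBoundInclinedLamellarTexture
import Summits.Ventures.Crystal3D.Theorems.StickyWulffConstantGenericWallFloorTwinAxis

/-!
# `PolycrystalWulffBound`, line `PolyDensity`: the texture form of the inclined-lamellar twin rung
# WITHOUT the wall-axis hypothesis — the twin axis is unique (crux `stmt-Ventures-19482`)

Route `StickyWulffConstant` of the venture `Summits/Ventures/Crystal3D`, second prover lane (poly-p2,
gen 9).  `rung_inclinedLamellar_texture` (`…InclinedLamellarTexture.lean`) asked the texture's wall data
to record the axis `m₀` on consecutive lamellae.  By the wall lane's `twin_axis_unique`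
(`…GenericWallFloorTwinAxis.lean`) the axis of a co-axial pair of DIFFERENT lattices is unique up to
sign (`coaxial_axis_eq_or_eq_neg`), so whatever axis `m f g` the crux's `Tex` clause provides for a twin
wall, `Dsc (m f g) = Dsc m₀`; and non-adjacent lamellae are at positive distance, so their wall terms
vanish for ANY wall body (`cruxIota_eq_zero_of_le_dist`).  Hence
**`rung_inclinedLamellar_texture'`**: the same conclusion `6·2^{1/3}(√2·Vol)^{2/3} ≤ En` with the only
lattice hypothesis «consecutive lamellae have different lattices».
WHAT THIS IS NOT: consecutive lamellae with equal lattices (merge them first / per-wall-δ runs);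
free facets in wall planes; fans; multi-axis; the crux is not claimed. -/

noncomputable section

open scoped BigOperators InnerProductSpace ENNReal Pointwise Topology
open MeasureTheory Filter Set

namespace Summit.Ventures.Crystal3D.Theorems

open Summit.Ventures.Crystal3D.Cruxes.TextureLiminf.TexShadow (E3)
open Literature.MathematicalPhysics.StatisticalMechanics (fccStacking barlowStacking IsHaggSeq)

/-- **The axis of a co-axial pair of different lattices is unique up to sign** (crux clause `Ax`). -/
theorem coaxial_axis_eq_or_eq_neg {m m' : E3} {A B : E3 ≃ₗᵢ[ℝ] E3}
    (h : ∃ (L : E3 ≃ₗᵢ[ℝ] E3) (s₁ s₂ : E3) (σ σ' : ℤ → ℤ), IsHaggSeq σ ∧ IsHaggSeq σ' ∧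
      L (EuclideanSpace.single (2 : Fin 3) (1 : ℝ)) = m ∧
      A '' fccStacking 1 (Real.sqrt (2 / 3)) ⊆
        (fun q => L q + s₁) '' barlowStacking 1 (Real.sqrt (2 / 3)) σ ∧
      B '' fccStacking 1 (Real.sqrt (2 / 3)) ⊆
        (fun q => L q + s₂) '' barlowStacking 1 (Real.sqrt (2 / 3)) σ')
    (h' : ∃ (L : E3 ≃ₗᵢ[ℝ] E3) (s₁ s₂ : E3) (σ σ' : ℤ → ℤ), IsHaggSeq σ ∧ IsHaggSeq σ' ∧
      L (EuclideanSpace.single (2 : Fin 3) (1 : ℝ)) = m' ∧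
      A '' fccStacking 1 (Real.sqrt (2 / 3)) ⊆
        (fun q => L q + s₁) '' barlowStacking 1 (Real.sqrt (2 / 3)) σ ∧
      B '' fccStacking 1 (Real.sqrt (2 / 3)) ⊆
        (fun q => L q + s₂) '' barlowStacking 1 (Real.sqrt (2 / 3)) σ')
    (hne : A '' fccStacking 1 (Real.sqrt (2 / 3)) ≠ B '' fccStacking 1 (Real.sqrt (2 / 3))) :
    m' = m ∨ m' = -m := by
  obtain ⟨L, s₁, s₂, σ, σ', hσ, hσ', hLm, h1, h2⟩ := h
  obtain ⟨L', t₁, t₂, τ, τ', hτ, hτ', hL'm, h1', h2'⟩ := h'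
  have conv : ∀ (X L₀ : E3 ≃ₗᵢ[ℝ] E3) (s : E3) (ρ : ℤ → ℤ), IsHaggSeq ρ →
      X '' fccStacking 1 (Real.sqrt (2 / 3)) ⊆
        (fun q => L₀ q + s) '' barlowStacking 1 (Real.sqrt (2 / 3)) ρ →
      X '' fccStacking 1 (Real.sqrt (2 / 3)) =
        L₀ '' barlowStacking 1 (Real.sqrt (2 / 3)) (fun _ : ℤ => ρ 0) := by
    intro X L₀ s ρ hρ hsub
    have hsub' : (fun p => X p + (0 : E3)) '' fccStacking 1 (Real.sqrt (2 / 3)) ⊆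
        (fun q => L₀ q + s) '' barlowStacking 1 (Real.sqrt (2 / 3)) ρ := by
      simpa only [add_zero] using hsub
    exact (linear_image_eq_frame_of_subset X L₀ 0 s hρ hsub').2
  have hA := conv A L s₁ σ hσ h1
  have hB := conv B L s₂ σ' hσ' h2
  have hA' := conv A L' t₁ τ hτ h1'
  have hB' := conv B L' t₂ τ' hτ' h2'
  have hfcc : barlowStacking 1 (Real.sqrt (2 / 3)) (fun _ : ℤ => (1 : ℤ)) =
      fccStacking 1 (Real.sqrt (2 / 3)) := rfl
  -- the axes
  have key : L' (EuclideanSpace.single (2 : Fin 3) (1 : ℝ)) = L (EuclideanSpace.single (2 : Fin 3) (1 : ℝ)) ∨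
      L' (EuclideanSpace.single (2 : Fin 3) (1 : ℝ)) = -L (EuclideanSpace.single (2 : Fin 3) (1 : ℝ)) := by
    refine twin_axis_unique L L' ?_
    rcases hσ 0 with hs | hs <;> rcases hσ' 0 with hs' | hs' <;> rw [hs] at hA <;> rw [hs'] at hB
    · exact absurd (hA.trans hB.symm) hne
    · rw [hfcc] at hA
      rcases hτ 0 with ht | ht <;> rcases hτ' 0 with ht' | ht' <;> rw [ht] at hA' <;> rw [ht'] at hB'
      · exact absurd (hA'.trans hB'.symm) hne
      · rw [hfcc] at hA'
        exact Or.inl ⟨hA'.symm.trans hA, hB'.symm.trans hB⟩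
      · rw [hfcc] at hB'
        exact Or.inr ⟨hB'.symm.trans hB, hA'.symm.trans hA⟩
      · exact absurd (hA'.trans hB'.symm) hne
    · rw [hfcc] at hB
      rcases hτ 0 with ht | ht <;> rcases hτ' 0 with ht' | ht' <;> rw [ht] at hA' <;> rw [ht'] at hB'
      · exact absurd (hA'.trans hB'.symm) hne
      · rw [hfcc] at hA'
        exact Or.inr ⟨hA'.symm.trans hA, hB'.symm.trans hB⟩
      · rw [hfcc] at hB'
        exact Or.inl ⟨hB'.symm.trans hB, hA'.symm.trans hA⟩
      · exact absurd (hA'.trans hB'.symm) hne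
    · exact absurd (hA.trans hB.symm) hne
  rw [← hLm, ← hL'm]
  exact key

end Summit.Ventures.Crystal3D.Theorems

namespace Summit.Ventures.Crystal3D.Cruxes.PolycrystalWulffBound.PolyDensity

open Summit.Ventures.Crystal3D.Theorems
open Summit.Ventures.Crystal3D.Cruxes.TextureLiminf.TexShadow (per polytope facetArea supportFn E3)
open Literature.MathematicalPhysics.StatisticalMechanics (fccStacking barlowStacking IsHaggSeq perimeter)

set_option maxHeartbeats 800000 in
/-- **Rung `rung_inclinedLamellar_texture'`**: as `rung_inclinedLamellar_texture`, with the wall-axis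
hypothesis removed (only «consecutive lamellae have different lattices» is kept). -/
theorem rung_inclinedLamellar_texture' :


    let Λ : Set (EuclideanSpace ℝ (Fin 3)) := Literature.MathematicalPhysics.StatisticalMechanics.fccStacking 1 (Real.sqrt (2 / 3));
    let Brl : (ℤ → ℤ) → Set (EuclideanSpace ℝ (Fin 3)) := Literature.MathematicalPhysics.StatisticalMechanics.barlowStacking 1 (Real.sqrt (2 / 3));
    let Ax : EuclideanSpace ℝ (Fin 3) → (EuclideanSpace ℝ (Fin 3) ≃ₗᵢ[ℝ] EuclideanSpace ℝ (Fin 3)) → (EuclideanSpace ℝ (Fin 3) ≃ₗᵢ[ℝ] EuclideanSpace ℝ (Fin 3)) → Prop := fun m A B => ∃ (L : EuclideanSpace ℝ (Fin 3) ≃ₗᵢ[ℝ] EuclideanSpace ℝ (Fin 3)) (s₁ s₂ : EuclideanSpace ℝ (Fin 3)) (σ σ' : ℤ → ℤ), Literature.MathematicalPhysics.StatisticalMechanics.IsHaggSeq σ ∧ Literature.MathematicalPhysics.StatisticalMechanics.IsHaggSeq σ' ∧ L (EuclideanSpace.single (2 : Fin 3) (1 : ℝ)) = m ∧ A '' Λ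 ⊆ (fun q => L q + s₁) '' Brl σ ∧ B '' Λ ⊆ (fun q => L q + s₂) '' Brl σ';
    let CoAx : (EuclideanSpace ℝ (Fin 3) ≃ₗᵢ[ℝ] EuclideanSpace ℝ (Fin 3)) → (EuclideanSpace ℝ (Fin 3) ≃ₗᵢ[ℝ] EuclideanSpace ℝ (Fin 3)) → Prop := fun A B => ∃ m, Ax m A B;
    let Φ : EuclideanSpace ℝ (Fin 3) → ℝ := fun ν => Real.sqrt 2 / 4 * ∑ᶠ w ∈ {w ∈ Λ | ‖w‖ = 1}, |⟪w, ν⟫_ℝ|;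
    let Per : Set (EuclideanSpace ℝ (Fin 3)) → Set (EuclideanSpace ℝ (Fin 3)) → ℝ := fun K S => (⨆ (ξ : EuclideanSpace ℝ (Fin 3) → EuclideanSpace ℝ (Fin 3)) (_ : ContDiff ℝ 1 ξ ∧ HasCompactSupport ξ ∧ ∀ z, ξ z ∈ K), ENNReal.ofReal (∫ z in S, Literature.MathematicalPhysics.StatisticalMechanics.fieldDivergence ξ z)).toReal;
    let ι : Set (EuclideanSpace ℝ (Fin 3)) → Set (EuclideanSpace ℝ (Fin 3)) → Set (EuclideanSpace ℝ (Fin 3)) → ℝ := fun K S₁ S₂ => (Per K S₁ + Per K S₂ - Per K (S₁ ∪ S₂)) / 2;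
    let W : (EuclideanSpace ℝ (Fin 3) ≃ₗᵢ[ℝ] EuclideanSpace ℝ (Fin 3)) → Set (EuclideanSpace ℝ (Fin 3)) := fun A => {y | ∀ ν : EuclideanSpace ℝ (Fin 3), ⟪y, ν⟫_ℝ ≤ Φ (A.symm ν)};
    let Dsc : EuclideanSpace ℝ (Fin 3) → Set (EuclideanSpace ℝ (Fin 3)) := fun m => {y | ‖y‖ ≤ 1 ∧ ⟪y, m⟫_ℝ = 0};
    let Tex : (n : ℕ) → (Fin n → Set (EuclideanSpace ℝ (Fin 3))) → (Fin n → (EuclideanSpace ℝ (Fin 3) ≃ₗᵢ[ℝ] EuclideanSpace ℝ (Fin 3))) → (Fin n → Fin n → ℝ) → (Fin n → Fin n → EuclideanSpace ℝ (Fin 3)) → Prop := fun n G A c m => (∀ f : Fin n, Literature.MathematicalPhysics.StatisticalMechanics.HasFinitePerimeter (G f) ∧ volume (G f) < ⊤) ∧ (∀ f g, f ≠ g → Disjoint (G f) (G g)) ∧ (∀ f g, f ≠ g → 0 ≤ c f g) ∧ (∀ f g, f ≠ g → ¬ CoAx (A f) (A g) → m f g = 0 ∧ 1 ≤ c f g)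 ∧ (∀ f g, f ≠ g → CoAx (A f) (A g) → A f '' Λ ≠ A g '' Λ → Ax (m f g) (A f) (A g) ∧ 1 / 2 ≤ c f g);
    let En : (n : ℕ) → (Fin n → Set (EuclideanSpace ℝ (Fin 3))) → (Fin n → (EuclideanSpace ℝ (Fin 3) ≃ₗᵢ[ℝ] EuclideanSpace ℝ (Fin 3))) → (Fin n → Fin n → ℝ) → (Fin n → Fin n → EuclideanSpace ℝ (Fin 3)) → ℝ := fun n G A c m => ∑ f : Fin n, Per (W (A f)) (G f) - ∑ f, ∑ g, (if f = g then 0 else ι (W (A f)) (G f) (G g)) + ∑ f, ∑ g, (if f = g then 0 else c f g / 2 * ι (Dsc (m f g)) (G f) (G g));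
    let Vol : (n : ℕ) → (Fin n → Set (EuclideanSpace ℝ (Fin 3))) → ℝ := fun n G => (volume (⋃ f : Fin n, G f)).toReal;
    ∀ (k' : ℕ) (Hc : Fin k' → Finset ((EuclideanSpace ℝ (Fin 3)) × ℝ)) (nv : Fin k' → Fin k' → EuclideanSpace ℝ (Fin 3)),
      (∀ j, Bornology.IsBounded (polytope (Hc j))) →
      (∀ j j', j ≠ j' → Disjoint (polytope (Hc j)) (polytope (Hc j'))) →
      (∀ j j', j ≠ j' → ‖nv j j'‖ = 1 ∧ ∃ b : ℝ,
        closure (polytope (Hc j)) ∩ closure (polytope (Hc j')) ⊆ {x | ⟪nv j j', x⟫_ℝ = b}) →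
      (∀ j, ∀ q ∈ Hc j, ‖q.1‖ = 1) →
    ∀ (n' : ℕ) (G : Fin (n' + 1) → Set (EuclideanSpace ℝ (Fin 3)))
      (A : Fin (n' + 1) → (EuclideanSpace ℝ (Fin 3) ≃ₗᵢ[ℝ] EuclideanSpace ℝ (Fin 3)))
      (c : Fin (n' + 1) → Fin (n' + 1) → ℝ) (m : Fin (n' + 1) → Fin (n' + 1) → EuclideanSpace ℝ (Fin 3)),
      Tex (n' + 1) G A c m →
    ∀ (nrm : EuclideanSpace ℝ (Fin 3)), ‖nrm‖ = 1 → ∀ (a : Fin (n' + 2) → ℝ), StrictMono a →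
    ∀ (s : Fin (n' + 1) → Finset (Fin k')),
      (∀ f, G f = (⋃ j, polytope (Hc j)) ∩ {x | a f.castSucc < ⟪x, nrm⟫_ℝ ∧ ⟪x, nrm⟫_ℝ < a f.succ}) →
      (∀ f, G f = ⋃ j ∈ s f, polytope (Hc j)) →
      (∀ f g, f ≠ g → Disjoint (s f) (s g)) →
      (∀ f, ∀ j ∈ s f, (nrm, a f.succ) ∈ Hc j) →
      (∀ i : Fin n', ∀ j ∈ s i.castSucc, closure (polytope (Hc j)) ∩ {x | ⟪nrm, x⟫_ℝ = a i.castSucc.succ} ⊆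
        ⋃ j' ∈ s i.succ, closure (polytope (Hc j'))) →
      (∀ j ∈ s (Fin.last n'), closure (polytope (Hc j)) ∩ {x | ⟪nrm, x⟫_ℝ = a (Fin.last n').succ} = ∅) →
      (∀ i : Fin n', ∀ j ∈ s i.castSucc, ∀ j' ∈ s i.succ,
        (nv j j' = nrm ∨ nv j j' = -nrm) ∧ (nv j' j = nrm ∨ nv j' j = -nrm)) →
    ∀ (m₀ : EuclideanSpace ℝ (Fin 3)), (∀ f g, Ax m₀ (A f) (A g)) →
      (∀ i : Fin n', A i.castSucc '' Λ ≠ A i.succ '' Λ) →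
    6 * (2 : ℝ) ^ ((1 : ℝ) / 3) * (Real.sqrt 2 * Vol (n' + 1) G) ^ ((2 : ℝ) / 3) ≤ En (n' + 1) G A c m  := by
  intro Λ Brl Ax CoAx Φ Per ι W Dsc Tex En Vol k' Hc nv hbd hdisjQ hplane hunit n' G A c m hTex
    nrm hnrm a ha s hG hGs hsdisj hwall hGP hGPtop hnv m₀ hAx hadj
  classical
  obtain ⟨hfin, hdisjG, hc0, hnon, htwin⟩ := hTex
  -- constant wall axes
  have hTex' : Tex (n' + 1) G A c (fun _ _ => m₀) :=
    ⟨hfin, hdisjG, hc0, fun f g _ hnco => absurd ⟨m₀, hAx f g⟩ hnco,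
      fun f g hfg hco hne => ⟨hAx f g, (htwin f g hfg hco hne).2⟩⟩
  have h := rung_inclinedLamellar_texture k' Hc nv hbd hdisjQ hplane hunit n' G A c (fun _ _ => m₀) hTex'
    nrm hnrm a ha s hG hGs hsdisj hwall hGP hGPtop hnv m₀ hAx (fun i => ⟨rfl, rfl, hadj i⟩)
  -- the wall terms agree
  have hterm : ∀ f g : Fin (n' + 1), f ≠ g →
      ι (Dsc (m f g)) (G f) (G g) = ι (Dsc m₀) (G f) (G g) := by
    intro f g hfg
    by_cases hadjfg : g.val = f.val + 1 ∨ f.val = g.val + 1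
    · -- adjacent: different lattices, unique axis
      have hne : A f '' Λ ≠ A g '' Λ := by
        rcases hadjfg with hv | hv
        · have hlt : f.val < n' := by have := g.isLt; omega
          obtain ⟨i, hi1, hi2⟩ : ∃ i : Fin n', f = i.castSucc ∧ g = i.succ :=
            ⟨⟨f.val, hlt⟩, Fin.ext rfl, Fin.ext (by simp [hv])⟩
          subst hi1 hi2
          exact hadj i
        · have hlt : g.val < n' := by have := f.isLt; omega
          obtain ⟨i, hi1, hi2⟩ : ∃ i : Fin n', g = i.castSucc ∧ f = i.succ :=
            ⟨⟨g.val, hlt⟩, Fin.ext rfl, Fin.ext (by simp [hv])⟩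
          subst hi1 hi2
          exact (hadj i).symm
      obtain ⟨hAxfg, -⟩ := htwin f g hfg ⟨m₀, hAx f g⟩ hne
      have hm : m f g = m₀ ∨ m f g = -m₀ := coaxial_axis_eq_or_eq_neg (hAx f g) hAxfg hne
      have hDsc : Dsc (m f g) = Dsc m₀ := by
        rcases hm with hm | hm
        · rw [hm]
        · show {y : E3 | ‖y‖ ≤ 1 ∧ ⟪y, m f g⟫_ℝ = 0} = {y : E3 | ‖y‖ ≤ 1 ∧ ⟪y, m₀⟫_ℝ = 0}
          ext y
          simp only [mem_setOf_eq, hm, inner_neg_right, neg_eq_zero]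
      rw [hDsc]
    · -- non-adjacent: positive distance, both interface terms vanish
      have hadjfg' : g.val ≠ f.val + 1 ∧ f.val ≠ g.val + 1 := not_or.1 hadjfg
      have hsep : ∃ δ : ℝ, 0 < δ ∧ ∀ x ∈ G f, ∀ y ∈ G g, δ ≤ dist x y := by
        rcases lt_or_gt_of_ne (fun h => hfg (Fin.ext h)) with hlt | hgt
        · -- `f` below `g`, with a lamella in between
          have h2 : f.val + 2 ≤ g.val := by have := hadjfg'.1; omega
          refine ⟨a g.castSucc - a f.succ, sub_pos.2 (ha (by
            show f.succ < g.castSucc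
            rw [Fin.lt_def]; simp; omega)), fun x hx y hy => ?_⟩
          rw [hG f] at hx; rw [hG g] at hy
          have h1 : ⟪x, nrm⟫_ℝ < a f.succ := hx.2.2
          have h2' : a g.castSucc < ⟪y, nrm⟫_ℝ := hy.2.1
          calc a g.castSucc - a f.succ ≤ ⟪y, nrm⟫_ℝ - ⟪x, nrm⟫_ℝ := by linarith
            _ = ⟪y - x, nrm⟫_ℝ := by rw [inner_sub_left]
            _ ≤ ‖y - x‖ * ‖nrm‖ := real_inner_le_norm _ _
            _ = dist x y := by rw [hnrm, mul_one, dist_eq_norm']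
        · have h2 : g.val + 2 ≤ f.val := by have := hadjfg'.2; omega
          refine ⟨a f.castSucc - a g.succ, sub_pos.2 (ha (by
            show g.succ < f.castSucc
            rw [Fin.lt_def]; simp; omega)), fun x hx y hy => ?_⟩
          rw [hG f] at hx; rw [hG g] at hy
          have h1 : a f.castSucc < ⟪x, nrm⟫_ℝ := hx.2.1
          have h2' : ⟪y, nrm⟫_ℝ < a g.succ := hy.2.2
          calc a f.castSucc - a g.succ ≤ ⟪x, nrm⟫_ℝ - ⟪y, nrm⟫_ℝ := by linarith
            _ = ⟪x - y, nrm⟫_ℝ := by rw [inner_sub_left]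
            _ ≤ ‖x - y‖ * ‖nrm‖ := real_inner_le_norm _ _
            _ = dist x y := by rw [hnrm, mul_one, dist_eq_norm]
      obtain ⟨δ, hδ, hδsep⟩ := hsep
      have hz : ∀ v : E3, ι (Dsc v) (G f) (G g) = 0 := fun v =>
        cruxIota_eq_zero_of_le_dist (convex_cruxDisc v) (zero_mem_cruxDisc v) one_pos
          (cruxDisc_subset_closedBall v) (hfin f).1 (hfin g).1 hδ hδsep
      rw [hz, hz]
  have hEn : En (n' + 1) G A c m = En (n' + 1) G A c (fun _ _ => m₀) := by
    show ∑ f, Per (W (A f)) (G f) - ∑ f, ∑ g, (if f = g then 0 else ι (W (A f)) (G f) (G g)) +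
        ∑ f, ∑ g, (if f = g then 0 else c f g / 2 * ι (Dsc (m f g)) (G f) (G g)) =
      ∑ f, Per (W (A f)) (G f) - ∑ f, ∑ g, (if f = g then 0 else ι (W (A f)) (G f) (G g)) +
        ∑ f, ∑ g, (if f = g then 0 else c f g / 2 * ι (Dsc m₀) (G f) (G g))
    congr 1
    refine Finset.sum_congr rfl fun f _ => Finset.sum_congr rfl fun g _ => ?_
    by_cases hfg : f = g
    · rw [if_pos hfg, if_pos hfg]
    · rw [if_neg hfg, if_neg hfg, hterm f g hfg]
  rw [hEn]
  exact h

end Summit.Ventures.Crystal3D.Cruxes.PolycrystalWulffBound.PolyDensity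

end
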